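import Summits.CriticalPhenomena.Ising3DConformalLimit.Theorems.EnergyNotSigmaSquaredGapForcesFarMergingSandwichFourToTwoAuxDictionary
import Summits.CriticalPhenomena.Ising3DConformalLimit.Theorems.FKParityRobustnessIndependentStrandsJoinR1SecondMomentCurrents
import Literature.Probability.LatticeModels.CurrentExploration
import Literature.Probability.LatticeModels.SourcedDoubleCurrentsSwitching
import Literature.Probability.Percolation.PercolationProofs
import HarnessLib

/-!
# Crux `WindowForcesU4` (stmt-CriticalPhenomena-5505), line `backbone-thinning-window` (reshape r1):
# stub `stub_mergeOfBackbonesMeet` — BACKBONE INTERSECTION FORCES TWO-CURRENT MERGING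

In the free box `Λ_n ⊂ ℤ³` at `β_c(3)`, for box vertices `a b a' b'` reading the dilated shape
`L•y₀, L•y₁, L•y₂, L•y₃`, and the pair law `P^{ab} ⊗ P^{a'b'}_{Λ_n}` (`doubleCurrentMeasure`): if the
Aizenman exploration backbone `vis (explore rk n₁ {b} a)` of `n₁` from `a` (target `b`) and the backbone
`vis (explore rk n₂ {b'} a')` of `n₂` from `a'` (target `b'`) share a vertex `v`, then `v ∈ C_{n₁}(a)` and
`v ∈ C_{n₂}(a')` (visited sites are touched, touched sites lie in the cluster of the start:
`Current.vis_subset_tch_explore`, `Current.tch_explore_subset_cluster`), hence `a ↔ a'` in the trace of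
`n₁ + n₂` (`smc_mem_tracedConn_of_mem_cluster`), i.e. the pair of currents lies in
`tracedConn (freeBoxGraph 3 n) a a'`. The line's two-current merging probability `merge n (L•y)`
(ADC21 (3.11), `sourcedDoubleCurrentLaw` = push-forward of `doubleCurrentMeasure` under `sourcedTrace`)
read on the currents IS the `doubleCurrentMeasure`-mass of `tracedConn … a a'`
(`sourcedDoubleCurrentLaw_apply`, `boxSources_pair`, `sourcedTrace_preimage_openConn` — the `hmerge` step of
`merge_le_meet_of_mem_box_succ` in `Theorems/EnergyNotSigmaSquaredGapForcesFarMergingSandwichFourToTwoAuxDictionary`),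
so monotonicity of the (finite) measure gives
`P^{ab} ⊗ P^{a'b'}_{Λ_n}[Γ₁ ∩ Γ₂ ≠ ∅] ≤ merge n (L•y)`.

Everything is proved; no definition and no named fact is introduced. The hypotheses `Function.Injective y`
and `1 ≤ L` of the registered signature are not used.

References: M. Aizenman, Comm. Math. Phys. 86 (1982) §5 Prop. 5.3, §9; M. Aizenman, H. Duminil-Copin,
Ann. of Math. 194 (2021) = arXiv:1912.07973, §3 (3.11).
-/

noncomputable section

open MeasureTheory
open Literature.Probability.LatticeModels Literature.Probability.Percolation
open scoped symmDiff ENNReal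
open Summit.CriticalPhenomena.Ising3DConformalLimit.GapForcesFarMergingSandwich (merge)
open Summit.CriticalPhenomena.Ising3DConformalLimit.Theorems.StubSecondMomentCurrents
  (smc_mem_tracedConn_of_mem_cluster smc_doubleCurrentMeasure_ne_top)

namespace Summit.CriticalPhenomena.Ising3DConformalLimit.LatticeSDPCertificatesWindowForcesU4.MergeOfBackbonesMeetProof

section Graph

variable {V : Type*} [Fintype V] [DecidableEq V] {G : SimpleGraph V} [DecidableRel G.Adj]

/-- **The backbone hangs on its start.** The visited sites of Aizenman's exploration walk of a current
`m` from `a` (any bond ranking `rk`, any target set `Y`) lie in the cluster `C_m(a)` of the start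
(visited ⊆ touched ⊆ cluster). [cite: AizenmanCMP1982, §9] -/
theorem vis_explore_subset_cluster (rk : G.edgeFinset → ℕ) (m : Current G) (Y : Finset V) (a : V) :
    (Current.explore rk m Y a).vis ⊆ m.cluster a :=
  (Current.vis_subset_tch_explore a).trans (Current.tch_explore_subset_cluster a)

/-- **Meeting backbones connect the starts.** If the backbone of `p₁` from `a` (target `b`) and the
backbone of `p₂` from `a'` (target `b'`) share a vertex, then `a ↔ a'` in the trace of `p₁ + p₂`:
`{Γ₁ ∩ Γ₂ ≠ ∅} ⊆ tracedConn G a a'`. [cite: AizenmanCMP1982, §5 Prop. 5.3] -/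
theorem backbonesMeet_subset_tracedConn (rk : G.edgeFinset → ℕ) (a b a' b' : V) :
    {p : Current G × Current G |
        ((Current.explore rk p.1 {b} a).vis ∩ (Current.explore rk p.2 {b'} a').vis).Nonempty} ⊆
      tracedConn G a a' := by
  rintro p ⟨v, hv⟩
  rw [Finset.mem_inter] at hv
  exact smc_mem_tracedConn_of_mem_cluster G (vis_explore_subset_cluster rk p.1 {b} a hv.1)
    (vis_explore_subset_cluster rk p.2 {b'} a' hv.2)

end Graph

/-- **The merging probability read on the currents** (the `hmerge` step of the dictionary file's
`merge_le_meet_of_mem_box_succ`): for box vertices `a b a' b'` with `↑a = L•y₀`, `↑b = L•y₁`, `↑a' = L•y₂`,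
`↑b' = L•y₃`,
`merge n (L•y) = (P^{ab} ⊗ P^{a'b'}_{Λ_n}[a ↔ a' in n₁ + n₂]).toReal`
(`sourcedDoubleCurrentLaw` is the push-forward of `doubleCurrentMeasure` under the lifted trace; the pull-back of
`{L•y₀ ↔ L•y₂}` is `tracedConn … a a'`). [cite: AizenmanDuminilCopinAnnals2021, eq. (3.11)] -/
theorem merge_smul_eq_toReal (y : Fin 4 → Site 3) (L n : ℕ) (a b a' b' : BoxVertex 3 n)
    (ha : (a : Site 3) = (L : ℤ) • y 0) (hb : (b : Site 3) = (L : ℤ) • y 1)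
    (ha' : (a' : Site 3) = (L : ℤ) • y 2) (hb' : (b' : Site 3) = (L : ℤ) • y 3) :
    merge n (fun i => (L : ℤ) • y i) =
      (doubleCurrentMeasure (freeBoxGraph 3 n) (criticalBeta 3) ({a} ∆ {b}) ({a'} ∆ {b'})
        (tracedConn (freeBoxGraph 3 n) a a')).toReal := by
  have h0 : merge n (fun i => (L : ℤ) • y i) =
      (sourcedDoubleCurrentLaw 3 n (criticalBeta 3) ({(a : Site 3)} ∆ {(b : Site 3)})
          ({(a' : Site 3)} ∆ {(b' : Site 3)})).real (openConn (a : Site 3) (a' : Site 3)) := by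
    rw [ha, hb, ha', hb']
    rfl
  rw [h0, measureReal_def,
    sourcedDoubleCurrentLaw_apply _ _ _ _ (measurableSet_openConn_holds (a : Site 3) (a' : Site 3)),
    boxSources_pair, boxSources_pair, sourcedTrace_preimage_openConn]

/-- **Stub `stub_mergeOfBackbonesMeet` (BACKBONE INTERSECTION FORCES MERGING).** For the pair law
`P^{ab} ⊗ P^{a'b'}_{Λ_n}` (`doubleCurrentMeasure` of the free box graph at `β_c(3)`), with `a b a' b'` the box
vertices of the dilated shape `L•y`: if the backbone of `n₁` from `a` (target `b`) and the backbone of `n₂`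
from `a'` (target `b'`) share a vertex then `a ↔ a'` in the trace of `n₁ + n₂`, so the intersection
probability is at most the two-current merging probability `merge n (L•y)` of ADC21 (3.11).
[cite: AizenmanDuminilCopinAnnals2021, eq. (3.11)] -/
theorem stub_mergeOfBackbonesMeet :
    ∀ y : Fin 4 → Site 3, Function.Injective y → ∀ (L n : ℕ)
      (rk : (freeBoxGraph 3 n).edgeFinset → ℕ) (a b a' b' : BoxVertex 3 n),
      (a : Site 3) = (L : ℤ) • y 0 → (b : Site 3) = (L : ℤ) • y 1 →
      (a' : Site 3) = (L : ℤ) • y 2 → (b' : Site 3) = (L : ℤ) • y 3 → 1 ≤ L →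
      (doubleCurrentMeasure (freeBoxGraph 3 n) (criticalBeta 3) ({a} ∆ {b}) ({a'} ∆ {b'})).real
          {p | ((Current.explore rk p.1 {b} a).vis ∩ (Current.explore rk p.2 {b'} a').vis).Nonempty} ≤
        merge n (fun i => (L : ℤ) • y i) := by
  intro y _hy L n rk a b a' b' ha hb ha' hb' _hL
  rw [merge_smul_eq_toReal y L n a b a' b' ha hb ha' hb', measureReal_def]
  exact ENNReal.toReal_mono (smc_doubleCurrentMeasure_ne_top _ (criticalBeta_nonneg 3) _ _ _)
    (measure_mono (backbonesMeet_subset_tracedConn rk a b a' b'))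

end Summit.CriticalPhenomena.Ising3DConformalLimit.LatticeSDPCertificatesWindowForcesU4.MergeOfBackbonesMeetProof

end
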